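import Literature.NumberTheory.DiophantineGeometry.FrobeniusCorrespondence
import Summits.ResolutionOfSingularities.ResolutionOfSingularities.Theorems.FrobeniusClosingClosingLemmaProducts
import Mathlib.RingTheory.Nullstellensatz
import HarnessLib

/-!
# Closing lemma toolkit (3): the twisted Lang–Weil estimate for an arbitrary finite index type

Route `FrobeniusClosing`, support item `ClosingLemma` (stmt-ResolutionOfSingularities-16348).

The vendored named fact `Literature.NumberTheory.DiophantineGeometry.Varshavsky2014.cor2_affine`
(Varshavsky 2018, Cor. 2 = Hrushovski 2004, Cor. 1.2: the Frobenius-twisted points of an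
irreducible bi-dominant affine correspondence are Zariski dense) is stated with coordinates indexed
by `Fin N`.  `cor2_of_fintype` transports it VERBATIM to coordinates indexed by any finite type `ι`
(renaming along `Fintype.equivFin ι`), which is the form the closing step of `ClosingLemma` uses
(`ι = Fin r × Fin N`, the cyclic product of `r` edge correspondences).  Nothing but bookkeeping:
`eval (y ∘ e) f = eval y (rename e f)`, vanishing ideals of reindexed point sets
(`ClosingArena.vanishingIdeal_reindex`), and `frob` commutes with reindexing. OURS. [folklore]
-/

noncomputable section

-- single-problem summit: the doubled namespace component `ResolutionOfSingularities` is forced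
set_option linter.dupNamespace false

open MvPolynomial
open Literature.NumberTheory.DiophantineGeometry.Varshavsky2014 (locus IsDefinedOver frob cor2_affine)

namespace Summit.ResolutionOfSingularities.ResolutionOfSingularities.Theorems.FrobeniusClosing.ClosingArena

variable {F : Type*} [Field F]

/-- The locus of renamed equations is the reindexed locus. [folklore] -/
theorem locus_rename_image {α β : Type*} (e : α ≃ β) (S : Set (MvPolynomial α F))
    (g : MvPolynomial α F) :
    locus (rename e '' S) (rename e g) = {y : β → F | y ∘ e ∈ locus S g} := by
  ext y
  simp only [locus, Set.mem_setOf_eq, Set.forall_mem_image, eval_rename]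

/-- `IsDefinedOver` is invariant under renaming along an equivalence. [folklore] -/
theorem isDefinedOver_rename {α β : Type*} (e : α ≃ β) (q : ℕ) {f : MvPolynomial α F}
    (hf : IsDefinedOver q f) : IsDefinedOver q (rename e f) := by
  intro m
  have hm : m = Finsupp.mapDomain e (Finsupp.mapDomain e.symm m) := by
    rw [← Finsupp.mapDomain_comp]
    simp
  rw [hm, coeff_rename_mapDomain _ e.injective]
  exact hf _

/-- `frob` commutes with reindexing of the coordinates. [folklore] -/
theorem frob_comp {α β : Type*} (q n : ℕ) (x : β → F) (e : α → β) :
    frob q n x ∘ e = frob q n (x ∘ e) := rfl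

omit [Field F] in
/-- The first projection of a reindexed correspondence is the reindexed first projection.
[folklore] -/
theorem image_inl_reindex {α β : Type*} (e : α ≃ β) (C : Set (α ⊕ α → F)) :
    (fun w => w ∘ Sum.inl) '' {w : β ⊕ β → F | w ∘ Equiv.sumCongr e e ∈ C} =
      {y : β → F | y ∘ e ∈ (fun w => w ∘ Sum.inl) '' C} := by
  ext y
  simp only [Set.mem_image, Set.mem_setOf_eq]
  constructor
  · rintro ⟨w, hw, rfl⟩
    exact ⟨_, hw, rfl⟩
  · rintro ⟨w, hw, hwy⟩
    refine ⟨w ∘ (Equiv.sumCongr e e).symm, ?_, ?_⟩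
    · have : (w ∘ ⇑(Equiv.sumCongr e e).symm) ∘ ⇑(Equiv.sumCongr e e) = w := by
        funext s; simp
      rw [this]; exact hw
    · funext b
      have hb := congrFun hwy (e.symm b)
      simp only [Function.comp_apply, Equiv.apply_symm_apply] at hb
      simp [← hb]

omit [Field F] in
/-- The second projection of a reindexed correspondence is the reindexed second projection.
[folklore] -/
theorem image_inr_reindex {α β : Type*} (e : α ≃ β) (C : Set (α ⊕ α → F)) :
    (fun w => w ∘ Sum.inr) '' {w : β ⊕ β → F | w ∘ Equiv.sumCongr e e ∈ C} =
      {y : β → F | y ∘ e ∈ (fun w => w ∘ Sum.inr) '' C} := by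
  ext y
  simp only [Set.mem_image, Set.mem_setOf_eq]
  constructor
  · rintro ⟨w, hw, rfl⟩
    exact ⟨_, hw, rfl⟩
  · rintro ⟨w, hw, hwy⟩
    refine ⟨w ∘ (Equiv.sumCongr e e).symm, ?_, ?_⟩
    · have : (w ∘ ⇑(Equiv.sumCongr e e).symm) ∘ ⇑(Equiv.sumCongr e e) = w := by
        funext s; simp
      rw [this]; exact hw
    · funext b
      have hb := congrFun hwy (e.symm b)
      simp only [Function.comp_apply, Equiv.apply_symm_apply] at hb
      simp [← hb]

/-- **Varshavsky's Cor. 2 (vendored named fact `cor2_affine`) for coordinates indexed by an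
arbitrary finite type `ι`**, obtained from the `Fin N` form by renaming along `Fintype.equivFin ι`.
Conditional on the named fact (hypothesis `hcor2`). [cite: Varshavsky2014, Cor. 2]
[cite: Hrushovski2004, Cor. 1.2] -/
theorem cor2_of_fintype (hcor2 : cor2_affine) (p : ℕ) [Fact p.Prime] (F : Type) [Field F]
    [Algebra (ZMod p) F] [IsAlgClosed F] [Algebra.IsAlgebraic (ZMod p) F] (a : ℕ) (ha : 0 < a)
    {ι : Type} [Fintype ι] (S : Set (MvPolynomial ι F)) (g : MvPolynomial ι F)
    (T : Set (MvPolynomial (ι ⊕ ι) F)) (h : MvPolynomial (ι ⊕ ι) F)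
    (hS : ∀ f ∈ S, IsDefinedOver (p ^ a) f) (hg : IsDefinedOver (p ^ a) g)
    (hX : (MvPolynomial.vanishingIdeal F (locus S g)).IsPrime)
    (hC : (MvPolynomial.vanishingIdeal F (locus T h)).IsPrime)
    (hsub : ∀ w ∈ locus T h, (w ∘ Sum.inl) ∈ locus S g ∧ (w ∘ Sum.inr) ∈ locus S g)
    (hdom₁ : MvPolynomial.vanishingIdeal F ((fun w => w ∘ Sum.inl) '' locus T h) =
      MvPolynomial.vanishingIdeal F (locus S g))
    (hdom₂ : MvPolynomial.vanishingIdeal F ((fun w => w ∘ Sum.inr) '' locus T h) =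
      MvPolynomial.vanishingIdeal F (locus S g))
    (n₀ : ℕ) (h' : MvPolynomial (ι ⊕ ι) F) (hh' : ∃ w ∈ locus T h, MvPolynomial.eval w h' ≠ 0) :
    ∃ (n : ℕ) (w : ι ⊕ ι → F), n₀ ≤ n ∧ w ∈ locus T h ∧
      MvPolynomial.eval w h' ≠ 0 ∧ w ∘ Sum.inr = frob (p ^ a) n (w ∘ Sum.inl) := by
  classical
  set N := Fintype.card ι with hN
  set e : ι ≃ Fin N := Fintype.equivFin ι with he
  set e₂ : ι ⊕ ι ≃ Fin N ⊕ Fin N := Equiv.sumCongr e e with he₂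
  -- the renamed data
  set S' : Set (MvPolynomial (Fin N) F) := rename e '' S with hS'
  set g' : MvPolynomial (Fin N) F := rename e g with hg'
  set T' : Set (MvPolynomial (Fin N ⊕ Fin N) F) := rename e₂ '' T with hT'
  set hh : MvPolynomial (Fin N ⊕ Fin N) F := rename e₂ h with hhh
  have hX' : locus S' g' = {y : Fin N → F | y ∘ e ∈ locus S g} := locus_rename_image e S g
  have hC' : locus T' hh = {w : Fin N ⊕ Fin N → F | w ∘ e₂ ∈ locus T h} :=
    locus_rename_image e₂ T h
  have hS'def : ∀ f ∈ S', IsDefinedOver (p ^ a) f := by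
    rintro _ ⟨f, hf, rfl⟩
    exact isDefinedOver_rename e _ (hS f hf)
  have hg'def : IsDefinedOver (p ^ a) g' := isDefinedOver_rename e _ hg
  have hX'prime : (MvPolynomial.vanishingIdeal F (locus S' g')).IsPrime := by
    rw [hX']; exact isPrime_vanishingIdeal_reindex e _ hX
  have hC'prime : (MvPolynomial.vanishingIdeal F (locus T' hh)).IsPrime := by
    rw [hC']; exact isPrime_vanishingIdeal_reindex e₂ _ hC
  have hsub' : ∀ w ∈ locus T' hh, (w ∘ Sum.inl) ∈ locus S' g' ∧ (w ∘ Sum.inr) ∈ locus S' g' := by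
    intro w hw
    rw [hC'] at hw
    rw [hX']
    exact ⟨(hsub _ hw).1, (hsub _ hw).2⟩
  have hdom₁' : MvPolynomial.vanishingIdeal F ((fun w => w ∘ Sum.inl) '' locus T' hh) =
      MvPolynomial.vanishingIdeal F (locus S' g') := by
    rw [hC', hX', he₂, image_inl_reindex, vanishingIdeal_reindex, vanishingIdeal_reindex, hdom₁]
  have hdom₂' : MvPolynomial.vanishingIdeal F ((fun w => w ∘ Sum.inr) '' locus T' hh) =
      MvPolynomial.vanishingIdeal F (locus S' g') := by
    rw [hC', hX', he₂, image_inr_reindex, vanishingIdeal_reindex, vanishingIdeal_reindex, hdom₂]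
  have hh'' : ∃ w ∈ locus T' hh, MvPolynomial.eval w (rename e₂ h') ≠ 0 := by
    obtain ⟨w, hw, hne⟩ := hh'
    refine ⟨w ∘ e₂.symm, ?_, ?_⟩
    · rw [hC']
      show (w ∘ ⇑e₂.symm) ∘ ⇑e₂ ∈ locus T h
      have : (w ∘ ⇑e₂.symm) ∘ ⇑e₂ = w := by funext s; simp
      rw [this]; exact hw
    · rw [eval_rename]
      have : (w ∘ ⇑e₂.symm) ∘ ⇑e₂ = w := by funext s; simp
      rw [this]; exact hne
  obtain ⟨n, w, hn, hw, hne, hfrob⟩ := hcor2 p F a ha N S' g' T' hh hS'def hg'def hX'prime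
    hC'prime hsub' hdom₁' hdom₂' n₀ (rename e₂ h') hh''
  refine ⟨n, w ∘ e₂, hn, ?_, ?_, ?_⟩
  · rw [hC'] at hw; exact hw
  · rw [eval_rename] at hne; exact hne
  · funext i
    have := congrFun hfrob (e i)
    simpa [he₂, frob] using this

end Summit.ResolutionOfSingularities.ResolutionOfSingularities.Theorems.FrobeniusClosing.ClosingArena

end
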